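import Literature.Topology.FourManifolds.ConnectedSumAmphichiralUniqueness
import Literature.Topology.FourManifolds.SphereIsometryDiffeotopy
import Literature.Topology.FourManifolds.KirbyCalculus
import Literature.Topology.FourManifolds.SphereTwoProdCircleSumFundamentalGroup
import HarnessLib

/-!
# `#ᵏ(S² × S¹)` is well defined up to diffeomorphism (`IsSphereTwoProdCircleSum k` has one diffeomorphism type)

Topic `Literature/Topology/FourManifolds`.  The tree's predicate `IsSphereTwoProdCircleSum k M`
(`KirbyCalculus.lean`) says "`M ≅ #ᵏ(S² × S¹)`" recursively through the HONEST gluing predicate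
`IsConnectedSum` (`ConnectedSum.lean`): `M ≅ S³` for `k = 0`, and `M` is *a* connected sum
`M' # (S² × S¹)` — along arbitrary smooth discs, no orientation convention — of some `M'` with
`IsSphereTwoProdCircleSum k M'` for `k + 1`.  This file proves that the predicate nevertheless
pins down ONE diffeomorphism type:

* `Literature.Topology.FourManifolds.sphereTwoProdCircle_discs_equivalent` — **any two discs
  `ℝ³ → S² × S¹` are related by a diffeomorphism of `S² × S¹`** (on the closed unit ball).  By the
  tree's `discs_equivalent_of_equivariant_disc` (the unoriented disc theorem,
  `UnorientedDiscTheorem.lean`; Hirsch Ch. 8 §3 Thm. 3.1, Kosinski III (3.6)) it suffices to give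
  one reflection-equivariant disc: `c = (σ₂⁻¹ × σ₁⁻¹) ∘ Λ` for the stereographic charts `σ₂` of
  `S²`, `σ₁` of `S¹` and the splitting `Λ : ℝ³ ≅ ℝ² × ℝ¹`, equivariant under
  `ρ = sphereCongr J × id` with `J` the isometry of `ℝ³` which is the reflection of the first
  coordinate in the chart `σ₂` (`exists_linearIsometryEquiv_stereographic'_conj`) — the classical
  remark that `S² × S¹` admits an orientation-reversing diffeomorphism (a reflection of the `S²`
  factor), exactly as the tree does for `S² × S²` (`sphereTwoProd_discs_equivalent`,
  `Barriers/SmoothPoincare4/ExoticContractibleKangStabilisationProofs.lean`).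
* `Literature.Topology.FourManifolds.nonempty_diffeomorph_of_isConnectedSum_sphereTwoProdCircle`
  — hence **`M # (S² × S¹)` is well defined**: any two connected sums of a connected `M` (any
  model over `ℝ³`) with `S² × S¹` are diffeomorphic (Kervaire–Milnor (1963), Lemma 2.1 with the
  remark on orientation-reversing automorphisms; Kosinski VI (1.1); Hempel (1976), Ch. 3,
  Lemma 3.1–3.2 for `3`-manifolds), by
  `nonempty_diffeomorph_of_isConnectedSum_of_discs_equivalent`.
* `Literature.Topology.FourManifolds.IsSphereTwoProdCircleSum.nonempty_diffeomorph` — **two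
  `3`-manifolds satisfying `IsSphereTwoProdCircleSum k` are diffeomorphic**, by induction on `k`
  (`k = 0`: both are `S³`; `k + 1`: the summands `M'` are diffeomorphic by induction, transport
  one connected sum along that diffeomorphism, `IsConnectedSum.of_diffeomorph_left`, and compare
  the two connected sums `M' # (S² × S¹)` by the previous theorem; the summands are connected,
  `IsSphereTwoProdCircleSum.pathConnectedSpace`).

Everything is proved; no definition and no named fact is introduced (the linear-algebra data are
packaged as an existence lemma, as in the `S² × S²` file; the spaces are written out,
`EuclideanSpace ℝ (Fin n)` and `Metric.sphere 0 1`, no local notation).  Consumer: the reduction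
of `diffeomorph_sumS1S2_of_isFreeOfRank_fundamentalGroup` (closed orientable `3`-manifolds with
free `π₁` are `#ᵏ(S¹ × S²)`) to Hempel's Thm. 5.3 in `IsSphereTwoProdCircleSum` language
(`FreeFundamentalGroupThreeManifoldProofs.lean`, §7, hypothesis (HU)).

## References

* M. Kervaire, J. Milnor, *Groups of homotopy spheres I*, Ann. of Math. 77 (1963), §2,
  Lemma 2.1. [KervaireMilnorAnnals1963]
* A. Kosinski, *Differential Manifolds* (1993), Ch. III Thm. (3.6), Ch. VI §1 Thm. (1.1).
  [Kosinski1993]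
* J. Hempel, *3-Manifolds*, Ann. of Math. Studies 86 (1976), Ch. 3 (Lemma 3.1, 3.2: the connected
  sum of `3`-manifolds is well defined). [Hempel1976]
* M. W. Hirsch, *Differential Topology*, GTM 33 (1976), Ch. 8 §3, Thm. 3.1. [HirschDT1976]
-/

noncomputable section

open scoped Manifold ContDiff Topology RealInnerProductSpace
open Set Module Function Filter OpenPartialHomeomorph Metric

namespace Literature.Topology.FourManifolds

/-! ### Linear algebra on `ℝ³ = ℝ² × ℝ¹`: splitting and the reflection of the first coordinate -/

/-- **Splitting `ℝ³ ≅ ℝ² × ℝ¹` and a compatible pair of reflections.** There are a linear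
isomorphism `Λ : ℝ³ ≅ ℝ² × ℝ¹` (`y ↦ ((y₀, y₁), y₂)`), a linear isometry `r` of `ℝ³` of negative
determinant (the reflection `y₀ ↦ -y₀`, Mathlib's `Submodule.reflection` in the hyperplane
orthogonal to `e₀`) and a linear isometry `r'` of `ℝ²` (the same reflection of the first factor)
with `Λ (r y) = (r' (Λ y).1, (Λ y).2)`.  Stated as an existence lemma (no definitions in this
file), after `exists_split_reflection` of the `S² × S²` file. [folklore] -/
theorem exists_split_reflection_three :
    ∃ (Λ : EuclideanSpace ℝ (Fin 3) ≃L[ℝ] EuclideanSpace ℝ (Fin 2) × EuclideanSpace ℝ (Fin 1))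
      (r : EuclideanSpace ℝ (Fin 3) ≃ₗᵢ[ℝ] EuclideanSpace ℝ (Fin 3))
      (r' : EuclideanSpace ℝ (Fin 2) ≃ₗᵢ[ℝ] EuclideanSpace ℝ (Fin 2)),
      LinearMap.det (r.toLinearEquiv : EuclideanSpace ℝ (Fin 3) →ₗ[ℝ] EuclideanSpace ℝ (Fin 3))
          < 0 ∧
        ∀ y, Λ (r y) = (r' (Λ y).1, (Λ y).2) := by
  -- the splitting isomorphism
  let Λ : EuclideanSpace ℝ (Fin 3) ≃ₗ[ℝ] EuclideanSpace ℝ (Fin 2) × EuclideanSpace ℝ (Fin 1) :=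
    { toFun := fun y => (!₂[y 0, y 1], !₂[y 2])
      invFun := fun z => !₂[z.1 0, z.1 1, z.2 0]
      map_add' := fun x y => by
        refine Prod.ext ?_ ?_
        · ext i; fin_cases i <;> simp
        · ext i; fin_cases i; simp
      map_smul' := fun a x => by
        refine Prod.ext ?_ ?_
        · ext i; fin_cases i <;> simp
        · ext i; fin_cases i; simp
      left_inv := fun y => by
        ext i
        fin_cases i <;> simp
      right_inv := fun z => by
        obtain ⟨a, b⟩ := z
        refine Prod.ext ?_ ?_
        · ext i; fin_cases i <;> simp
        · ext i; fin_cases i; simp }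
  -- the reflections of the first coordinate
  set e₀ : EuclideanSpace ℝ (Fin 3) := EuclideanSpace.single 0 1 with he₀_def
  set e₀' : EuclideanSpace ℝ (Fin 2) := EuclideanSpace.single 0 1 with he₀'_def
  have he₀ : e₀ ≠ 0 := fun h => by
    have := congrArg (fun v : EuclideanSpace ℝ (Fin 3) => v 0) h
    simp [he₀_def] at this
  have hr : ∀ y : EuclideanSpace ℝ (Fin 3), (ℝ ∙ e₀)ᗮ.reflection y = !₂[-(y 0), y 1, y 2] :=
    fun y => by
      rw [reflection_orthogonal_singleton_apply]
      ext i
      fin_cases i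
      · simp [he₀_def, EuclideanSpace.inner_single_left]; ring
      · simp [he₀_def, EuclideanSpace.inner_single_left]
      · simp [he₀_def, EuclideanSpace.inner_single_left]
  have hr' : ∀ a : EuclideanSpace ℝ (Fin 2), (ℝ ∙ e₀')ᗮ.reflection a = !₂[-(a 0), a 1] :=
    fun a => by
      rw [reflection_orthogonal_singleton_apply]
      ext i
      fin_cases i
      · simp [he₀'_def, EuclideanSpace.inner_single_left]; ring
      · simp [he₀'_def, EuclideanSpace.inner_single_left]
  refine ⟨Λ.toContinuousLinearEquiv, (ℝ ∙ e₀)ᗮ.reflection, (ℝ ∙ e₀')ᗮ.reflection, ?_, fun y => ?_⟩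
  · -- `det = -1`
    have h := (ℝ ∙ e₀)ᗮ.det_reflection
    have hKo : (ℝ ∙ e₀)ᗮᗮ = ℝ ∙ e₀ := Submodule.orthogonal_orthogonal _
    rw [hKo, finrank_span_singleton he₀, pow_one] at h
    have h' : LinearMap.det ((ℝ ∙ e₀)ᗮ.reflection.toLinearEquiv :
        EuclideanSpace ℝ (Fin 3) →ₗ[ℝ] EuclideanSpace ℝ (Fin 3)) = -1 := h
    rw [h']
    norm_num
  · -- coordinates
    rw [hr y]
    show (Λ !₂[-(y 0), y 1, y 2]) = ((ℝ ∙ e₀')ᗮ.reflection (Λ y).1, (Λ y).2)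
    rw [hr']
    refine Prod.ext ?_ ?_
    · ext i; fin_cases i <;> simp [Λ]
    · ext i; fin_cases i; simp [Λ]

/-! ### Every two discs of `S² × S¹` are equivalent -/

/-- **Any two discs `ℝ³ → S² × S¹` are related by a diffeomorphism of `S² × S¹`** (on the closed
unit ball): the hypothesis `hN` of `nonempty_diffeomorph_of_isConnectedSum_of_discs_equivalent`
for the summand `S² × S¹` with Mathlib's product of the round analytic structures (model
`(𝓡 2).prod (𝓡 1)`, the model used by `IsSphereTwoProdCircleSum`).  By
`discs_equivalent_of_equivariant_disc` (unoriented disc theorem in `S² × S¹`) it suffices to give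
one reflection-equivariant disc: `c = (σ₂⁻¹ × σ₁⁻¹) ∘ Λ` for the stereographic charts
`σ₂ = stereographic' 2 p`, `σ₁ = stereographic' 1 q`, equivariant under `ρ = sphereCongr J × id`,
`J` the isometry of `ℝ³` fixing `p` which is the reflection of the first coordinate in the chart
`σ₂` (`exists_linearIsometryEquiv_stereographic'_conj`).  This is the classical remark that
`S² × S¹` admits an orientation-reversing diffeomorphism (a reflection of the `S²` factor), whence
`M # (S² × S¹)` needs no orientation convention (Kervaire–Milnor 1963, §2; Kosinski 1993, VI §1;
Hempel 1976, Ch. 3). [cite: Kosinski1993, Ch. VI §1, Thm (1.1)]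
[cite: KervaireMilnorAnnals1963, §2, Lemma 2.1 (p. 505)] -/
theorem sphereTwoProdCircle_discs_equivalent
    (k k' : EuclideanSpace ℝ (Fin 3) →
      Metric.sphere (0 : EuclideanSpace ℝ (Fin 3)) 1 × Metric.sphere (0 : EuclideanSpace ℝ (Fin 2)) 1)
    (hk : Manifold.IsSmoothEmbedding 𝓘(ℝ, EuclideanSpace ℝ (Fin 3)) ((𝓡 2).prod (𝓡 1)) ∞ k)
    (hk' : Manifold.IsSmoothEmbedding 𝓘(ℝ, EuclideanSpace ℝ (Fin 3)) ((𝓡 2).prod (𝓡 1)) ∞ k') :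
    ∃ g : (Metric.sphere (0 : EuclideanSpace ℝ (Fin 3)) 1 ×
        Metric.sphere (0 : EuclideanSpace ℝ (Fin 2)) 1) ≃ₘ⟮(𝓡 2).prod (𝓡 1), (𝓡 2).prod (𝓡 1)⟯
        (Metric.sphere (0 : EuclideanSpace ℝ (Fin 3)) 1 ×
          Metric.sphere (0 : EuclideanSpace ℝ (Fin 2)) 1),
      ∀ y : EuclideanSpace ℝ (Fin 3), ‖y‖ ≤ 1 → g (k y) = k' y := by
  -- the dimension `Fact`s consumed by Mathlib's `stereographic'` (inside the proof only)
  haveI : Fact (finrank ℝ (EuclideanSpace ℝ (Fin 3)) = 2 + 1) := ⟨by simp⟩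
  haveI : Fact (finrank ℝ (EuclideanSpace ℝ (Fin 2)) = 1 + 1) := ⟨by simp⟩
  obtain ⟨Λ, r, r', hr, hΛr⟩ := exists_split_reflection_three
  -- the poles and their stereographic charts
  set p : Metric.sphere (0 : EuclideanSpace ℝ (Fin 3)) 1 :=
    ⟨EuclideanSpace.single 0 1, by simp⟩ with hp_def
  set q : Metric.sphere (0 : EuclideanSpace ℝ (Fin 2)) 1 :=
    ⟨EuclideanSpace.single 0 1, by simp⟩ with hq_def
  set σ := stereographic' 2 p with hσ_def
  set τ := stereographic' 1 q with hτ_def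
  have hσt : σ.target = univ := stereographic'_target p
  have hσs : σ.source = {p}ᶜ := stereographic'_source p
  have hτt : τ.target = univ := stereographic'_target q
  have hτs : τ.source = {q}ᶜ := stereographic'_source q
  -- the isometry of `ℝ³` fixing `p` which reads `r'` in the chart `σ`
  obtain ⟨J, hJp, hJ⟩ := exists_linearIsometryEquiv_stereographic'_conj p p r'
  have hJp' : sphereCongr J p = p := Subtype.ext (by simpa using hJp)
  have hJσ : ∀ a : EuclideanSpace ℝ (Fin 2), sphereCongr J (σ.symm a) = σ.symm (r' a) := by
    intro a
    have ha : a ∈ σ.target := by rw [hσt]; trivial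
    have h1 : σ.symm a ∈ σ.source := σ.map_target ha
    have h1' : σ.symm a ≠ p := by rw [hσs] at h1; exact h1
    have h2 : sphereCongr J (σ.symm a) ∈ σ.source := by
      rw [hσs]
      intro h
      exact h1' ((sphereCongr J).injective (h.trans hJp'.symm))
    have h3 : σ (sphereCongr J (σ.symm a)) = r' a := by
      rw [hJ (σ.symm a), σ.right_inv ha]
    rw [← h3, σ.left_inv h2]
  -- the product chart inverse is a disc `ℝ² × ℝ¹ → S² × S¹`
  have hc₀ : Manifold.IsSmoothEmbedding 𝓘(ℝ, EuclideanSpace ℝ (Fin 2) × EuclideanSpace ℝ (Fin 1))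
      ((𝓡 2).prod (𝓡 1)) ∞ (σ.prod τ).symm := by
    have hsrc : (σ.prod τ).symm.source = univ := by
      rw [OpenPartialHomeomorph.symm_source, OpenPartialHomeomorph.prod_target, hσt, hτt,
        univ_prod_univ]
    have hΦ : ContMDiffOn 𝓘(ℝ, EuclideanSpace ℝ (Fin 2) × EuclideanSpace ℝ (Fin 1))
        ((𝓡 2).prod (𝓡 1)) ∞ (σ.prod τ).symm (σ.prod τ).symm.source := by
      rw [hsrc, modelWithCornersSelf_prod, ← chartedSpaceSelf_prod]
      exact ((contMDiff_stereographic'_symm p).prodMap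
        (contMDiff_stereographic'_symm q)).contMDiffOn
    have hΦ' : ContMDiffOn ((𝓡 2).prod (𝓡 1))
        𝓘(ℝ, EuclideanSpace ℝ (Fin 2) × EuclideanSpace ℝ (Fin 1)) ∞ (σ.prod τ).symm.symm
        (σ.prod τ).symm.target := by
      rw [OpenPartialHomeomorph.symm_symm, OpenPartialHomeomorph.symm_target,
        OpenPartialHomeomorph.prod_source, hσs, hτs, modelWithCornersSelf_prod,
        ← chartedSpaceSelf_prod]
      exact (contMDiffOn_stereographic' p).prodMap (contMDiffOn_stereographic' q)
    exact isSmoothEmbedding_of_openPartialHomeomorph _ hsrc hΦ hΦ'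
      (ContinuousLinearEquiv.refl ℝ _)
  -- the equivariant disc `c = (σ⁻¹ × τ⁻¹) ∘ Λ` of `S² × S¹`
  have hc : Manifold.IsSmoothEmbedding 𝓘(ℝ, EuclideanSpace ℝ (Fin 3)) ((𝓡 2).prod (𝓡 1)) ∞
      ((σ.prod τ).symm ∘ (Λ : EuclideanSpace ℝ (Fin 3) → _)) := by
    have h := isSmoothEmbedding_disc_comp_symm hc₀ (by simp) Λ.symm
    rwa [ContinuousLinearEquiv.symm_symm] at h
  -- the symmetry `ρ = sphereCongr J × id`
  set ρ := (sphereCongr J).prodCongr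
    (Diffeomorph.refl (𝓡 1) (Metric.sphere (0 : EuclideanSpace ℝ (Fin 2)) 1) ∞) with hρ_def
  have hρ : ∀ y : EuclideanSpace ℝ (Fin 3),
      ρ (((σ.prod τ).symm ∘ (Λ : EuclideanSpace ℝ (Fin 3) → _)) y) =
        ((σ.prod τ).symm ∘ (Λ : EuclideanSpace ℝ (Fin 3) → _)) (r y) := by
    intro y
    simp only [comp_apply, hΛr, OpenPartialHomeomorph.prod_symm,
      OpenPartialHomeomorph.prod_apply, hρ_def, Diffeomorph.coe_prodCongr, Prod.map_apply,
      Diffeomorph.coe_refl, id_eq, hJσ]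
  -- connectedness of `S² × S¹`
  haveI : ConnectedSpace (Metric.sphere (0 : EuclideanSpace ℝ (Fin 3)) 1) := by
    refine isConnected_iff_connectedSpace.mp (isConnected_sphere ?_ 0 zero_le_one)
    rw [← Module.finrank_eq_rank, finrank_euclideanSpace_fin]
    norm_num
  haveI : ConnectedSpace (Metric.sphere (0 : EuclideanSpace ℝ (Fin 2)) 1) := by
    refine isConnected_iff_connectedSpace.mp (isConnected_sphere ?_ 0 zero_le_one)
    rw [← Module.finrank_eq_rank, finrank_euclideanSpace_fin]
    norm_num
  have hE : finrank ℝ (EuclideanSpace ℝ (Fin 3)) ≠ 0 := by simp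
  exact discs_equivalent_of_equivariant_disc (IN := (𝓡 2).prod (𝓡 1)) hE Λ r hr hc ρ hρ k k'
    hk hk'

/-! ### `M # (S² × S¹)` is well defined -/

section WellDefined

variable {HM HP HP' : Type*} [TopologicalSpace HM] [TopologicalSpace HP] [TopologicalSpace HP']
  {IM : ModelWithCorners ℝ (EuclideanSpace ℝ (Fin 3)) HM}
  {IP : ModelWithCorners ℝ (EuclideanSpace ℝ (Fin 3)) HP}
  {IP' : ModelWithCorners ℝ (EuclideanSpace ℝ (Fin 3)) HP'}
  {M P P' : Type*} [TopologicalSpace M] [T2Space M] [ChartedSpace HM M] [IsManifold IM ∞ M]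
  [TopologicalSpace P] [ChartedSpace HP P] [IsManifold IP ∞ P]
  [TopologicalSpace P'] [ChartedSpace HP' P'] [IsManifold IP' ∞ P']

/-- **`M # (S² × S¹)` is well defined up to diffeomorphism**: for a connected Hausdorff `C^∞`
manifold `M` with any real model over `ℝ³` (with or without boundary, orientable or not), any two
connected sums `P`, `P'` of `M` with `S² × S¹` in the tree's relational sense
(`IsConnectedSum`, along arbitrary discs; any models `IP`, `IP'` over `ℝ³`) are diffeomorphic —
`nonempty_diffeomorph_of_isConnectedSum_of_discs_equivalent` (unoriented disc theorem in `M`,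
uniqueness of open gluings) fed with `sphereTwoProdCircle_discs_equivalent` (Kervaire–Milnor
(1963), Lemma 2.1 and the remark that an orientation-reversing automorphism of a summand makes
the orientation convention immaterial; Kosinski (1993), VI (1.1); for `3`-manifolds Hempel
(1976), Ch. 3). [cite: KervaireMilnorAnnals1963, §2, Lemma 2.1 (p. 505)]
[cite: Kosinski1993, Ch. VI §1, Thm (1.1)] -/
theorem nonempty_diffeomorph_of_isConnectedSum_sphereTwoProdCircle [ConnectedSpace M]
    (h : IsConnectedSum IP IM ((𝓡 2).prod (𝓡 1)) M
      (Metric.sphere (0 : EuclideanSpace ℝ (Fin 3)) 1 × Metric.sphere (0 : EuclideanSpace ℝ (Fin 2)) 1)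
      P)
    (h' : IsConnectedSum IP' IM ((𝓡 2).prod (𝓡 1)) M
      (Metric.sphere (0 : EuclideanSpace ℝ (Fin 3)) 1 × Metric.sphere (0 : EuclideanSpace ℝ (Fin 2)) 1)
      P') :
    Nonempty (P ≃ₘ⟮IP, IP'⟯ P') := by
  obtain ⟨-, r, -, hr, -⟩ := exists_split_reflection_three
  have hE : finrank ℝ (EuclideanSpace ℝ (Fin 3)) ≠ 0 := by simp
  exact nonempty_diffeomorph_of_isConnectedSum_of_discs_equivalent hE r hr
    sphereTwoProdCircle_discs_equivalent h h'

end WellDefined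

/-! ### `IsSphereTwoProdCircleSum k` has one diffeomorphism type -/

/-- **Two `3`-manifolds which are `#ᵏ(S² × S¹)` in the sense of `IsSphereTwoProdCircleSum k` are
diffeomorphic** (Hausdorff `C^∞` manifolds on `ℝ³`).  Induction on `k`: for `k = 0` both are
diffeomorphic to `S³` (`isSphereTwoProdCircleSum_zero_iff`); for `k + 1`, `M` is a connected sum
`A # (S² × S¹)` and `M'` a connected sum `A' # (S² × S¹)` with `IsSphereTwoProdCircleSum k A`,
`IsSphereTwoProdCircleSum k A'`, so `A ≅ A'` by induction; transporting the first connected sum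
along this diffeomorphism (`IsConnectedSum.of_diffeomorph_left`, Kervaire–Milnor §2) makes `M` and
`M'` two connected sums of the connected manifold `A'`
(`IsSphereTwoProdCircleSum.pathConnectedSpace`) with `S² × S¹`, which are diffeomorphic by
`nonempty_diffeomorph_of_isConnectedSum_sphereTwoProdCircle`.  (Kervaire–Milnor (1963), Lemma 2.1:
"The connected sum operation is well defined, associative, and commutative up to orientation
preserving diffeomorphism"; here no orientations are needed since `S² × S¹` is amphichiral; Hempel
(1976), Ch. 3.) [cite: KervaireMilnorAnnals1963, §2, Lemma 2.1 (p. 505)]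
[cite: Hempel1976, Ch. 3, Lemma 3.1–3.2] -/
theorem IsSphereTwoProdCircleSum.nonempty_diffeomorph :
    ∀ (k : ℕ) (M : Type) [TopologicalSpace M] [T2Space M]
      [ChartedSpace (EuclideanSpace ℝ (Fin 3)) M] [IsManifold (𝓡 3) ∞ M]
      (M' : Type) [TopologicalSpace M'] [T2Space M']
      [ChartedSpace (EuclideanSpace ℝ (Fin 3)) M'] [IsManifold (𝓡 3) ∞ M'],
      IsSphereTwoProdCircleSum k M → IsSphereTwoProdCircleSum k M' →
        Nonempty (M ≃ₘ⟮𝓡 3, 𝓡 3⟯ M') := by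
  intro k
  induction k with
  | zero =>
    intro M _ _ _ _ M' _ _ _ _ h h'
    obtain ⟨e⟩ := (isSphereTwoProdCircleSum_zero_iff M).1 h
    obtain ⟨e'⟩ := (isSphereTwoProdCircleSum_zero_iff M').1 h'
    exact ⟨e.trans e'.symm⟩
  | succ k ih =>
    intro M _ _ _ _ M' _ _ _ _ h h'
    obtain ⟨A, _, _, _, _, hA, hsum⟩ := (isSphereTwoProdCircleSum_succ_iff k M).1 h
    obtain ⟨A', _, _, _, _, hA', hsum'⟩ := (isSphereTwoProdCircleSum_succ_iff k M').1 h'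
    obtain ⟨φ⟩ := ih A A' hA hA'
    haveI : PathConnectedSpace A' := hA'.pathConnectedSpace
    exact nonempty_diffeomorph_of_isConnectedSum_sphereTwoProdCircle (hsum.of_diffeomorph_left φ)
      hsum'

end Literature.Topology.FourManifolds

end
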